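/-
Copyright (c) 2026 the pub-hodgecm-mathlib formalisation cell (harness21).  Prover seat hodgecm-mathlib-K2Liu-p13 (g2), Track B «K2-LIT»,
#184♮ = hLiu418 = `stmt-HodgeConjecture-24832`; Road I v3 organ U1-CT-ind STAGE 2 (Q2), file F5-s (the finite-mass `ι(K)`-covering weight on `𝔸_K` taken by ★ F5-q).
-/
import Literature.NumberTheory.Automorphic.AdelicFundamentalDomain      -- ★ Tate's `adeleFundamentalDomain`, `existsUnique_add_algebraMap_mem_…`, `measure_…_lt_top`, `measurableSet_…`
import HarnessLib

/-!
# Crux `HLiu418`, Road I v3, organ U1 stage 2 (Q2), file F5-s: A MEASURABLE `ι(K)`-COVERING WEIGHT OF FINITE MASS ON `𝔸_K` —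
# the indicator of Tate's fundamental domain `D` (★ `AdelicFundamentalDomain`); the input `β₀` of ★ F5-q `exists_const_innerSectionOrbit_eq`

Cell `hodgecm-mathlib`, crux item hLiu418 = `stmt-HodgeConjecture-24832`; squad K2 ∕ K2Liu; LEAD F0P6-plan (g14), co-dealer K2E5-plan (g7); prover K2Liu-p13 (g2).
THEOREMS ONLY (no `def`, no instance, no notation, no named-fact hypothesis, no `sorry`); lane `--supports stmt-HodgeConjecture-24832 --as helper` (count-neutral).
GENERIC number field `K`, ANY measure `μ` on `𝔸_K` finite on compact sets:
* `tsum_indicator_adeleFundamentalDomain_eq_one` — `Σ_{l ∈ ι(K)} 𝟙_D(l + z) = 1` for every `z` (★ Tate's Thm. 4.1.3 (1) `existsUnique_add_algebraMap_mem_adeleFundamentalDomain`);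
* **`exists_latticeWeight`** — `∃ β₀, Measurable β₀ ∧ (∀ z, Σ'_{l : ↥(range ι)} β₀(↑l + z) = 1) ∧ ∫⁻ β₀ dμ ≠ ∞` (`β₀ = 𝟙_D`, ★ `measure_adeleFundamentalDomain_lt_top`): the hypotheses
  `hβ₀m ∕ hβ₀ ∕ hβ₀fin` of ★ F5-q `exists_const_innerSectionOrbit_eq` ∕ `eisensteinSeriesU_innerSection_rational_mul`, LETTER FOR LETTER.
[CasselsFrohlichANT1967, Ch. XV §4.1 Thm. 4.1.3], [WeilBNT1967, Ch. IV §2].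
HONEST LABEL.  Count-neutral helper: `HC_CM` is proved only modulo the 7 printed citations (2 remaining named inputs: hLiu418 = `stmt-HodgeConjecture-24832`,
h413 = `stmt-HodgeConjecture-24833`) until rung 0 closes.
-/

set_option autoImplicit false
set_option linter.dupNamespace false -- the mandated namespace repeats `HodgeConjecture.HodgeConjecture`

noncomputable section

open scoped ENNReal NNReal
open NumberField IsDedekindDomain MeasureTheory

namespace Summit.HodgeConjecture.HodgeConjecture.Cruxes.HLiu418.K2LiuAdelicLatticeWeight

open Literature.NumberTheory.Automorphic

variable {K : Type} [Field K] [NumberField K]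

/-- **`Σ_{l ∈ ι(K)} 𝟙_D(l + z) = 1`**: exactly one translate of `z` by a principal adele lies in Tate's fundamental domain.
[cite: CasselsFrohlichANT1967, Ch. XV Thm. 4.1.3 (1)] -/
theorem tsum_indicator_adeleFundamentalDomain_eq_one (z : AdeleRing (𝓞 K) K) :
    ∑' l : ↥((algebraMap K (AdeleRing (𝓞 K) K)).toAddMonoidHom.range),
      (adeleFundamentalDomain K).indicator (fun _ => (1 : ℝ≥0∞)) ((l : AdeleRing (𝓞 K) K) + z) = 1 := by
  classical
  obtain ⟨ξ, hξ, huniq⟩ := existsUnique_add_algebraMap_mem_adeleFundamentalDomain K z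
  set l₀ : ↥((algebraMap K (AdeleRing (𝓞 K) K)).toAddMonoidHom.range) := ⟨algebraMap K (AdeleRing (𝓞 K) K) ξ, ⟨ξ, rfl⟩⟩ with hl₀
  rw [tsum_eq_single l₀]
  · rw [Set.indicator_of_mem]; exact hξ
  · intro l hl
    rw [Set.indicator_of_notMem]
    intro hmem
    obtain ⟨ξ', hξ'⟩ := l.2
    apply hl
    have hmem' : algebraMap K (AdeleRing (𝓞 K) K) ξ' + z ∈ adeleFundamentalDomain K := by
      rw [← show ((algebraMap K (AdeleRing (𝓞 K) K)).toAddMonoidHom ξ' : AdeleRing (𝓞 K) K) = (l : AdeleRing (𝓞 K) K) from hξ'] at hmem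
      exact hmem
    have h := huniq ξ' hmem'
    subst h
    exact Subtype.ext hξ'.symm

/-- **A MEASURABLE `ι(K)`-COVERING WEIGHT OF FINITE MASS ON `𝔸_K`** (`β₀ = 𝟙_D`), for every measure finite on compact sets — the inputs `hβ₀m`, `hβ₀`, `hβ₀fin` of
★ F5-q. [cite: CasselsFrohlichANT1967, Ch. XV Thm. 4.1.3] [cite: WeilBNT1967, Ch. IV §2] -/
theorem exists_latticeWeight [MeasurableSpace (AdeleRing (𝓞 K) K)] [BorelSpace (AdeleRing (𝓞 K) K)] (μ : Measure (AdeleRing (𝓞 K) K))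
    [IsFiniteMeasureOnCompacts μ] :
    ∃ β₀ : AdeleRing (𝓞 K) K → ℝ≥0∞, Measurable β₀ ∧
      (∀ z, ∑' l : ↥((algebraMap K (AdeleRing (𝓞 K) K)).toAddMonoidHom.range), β₀ ((l : AdeleRing (𝓞 K) K) + z) = 1) ∧
      ∫⁻ z, β₀ z ∂μ ≠ ∞ := by
  refine ⟨(adeleFundamentalDomain K).indicator (fun _ => (1 : ℝ≥0∞)), ?_, tsum_indicator_adeleFundamentalDomain_eq_one, ?_⟩
  · exact measurable_const.indicator (measurableSet_adeleFundamentalDomain K)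
  · rw [lintegral_indicator (measurableSet_adeleFundamentalDomain K), MeasureTheory.setLIntegral_const, one_mul]
    exact (measure_adeleFundamentalDomain_lt_top K μ).ne

end Summit.HodgeConjecture.HodgeConjecture.Cruxes.HLiu418.K2LiuAdelicLatticeWeight

end
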